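import Literature.Computability.AlgebraicComplexity.BI17SL3InvariantDimensionProofs
import Literature.Computability.AlgebraicComplexity.BI17CayleyIrreducibleProofs
import HarnessLib

/-!
# `F_n` is irreducible (Bürgisser–Ikenmeyer 2017, §5.1, after Thm. 5.13) — PROOF

P. Bürgisser, C. Ikenmeyer, *Fundamental invariants of orbit closures*, J. Algebra **477** (2017)
390–434 = arXiv:1511.02927 [BurgisserIkenmeyer2017], §5.1, the sentence after the proof of
Thm. 5.13 (TeX `main.tex` L2345; held text `paper:arxiv-1511.02927` p0021:L24): "As for Lemma 3.19,
we can show that the generic fundamental invariant `F_n` is an irreducible polynomial." Lemma 3.19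
(p0011:L70, about Cayley's `P_{D,m}`): "This can be directly derived from the fact that … `P_{D,m}`
is a nonzero `SL_m`-invariant on `Sym^D ℂ^m` of smallest degree. For an analog argument see for
example [Ottaviani 2009]." THEOREM-ONLY file (no definitions, no named facts); it DISCHARGES the
named fact `BI2017_fundInvariantTensor_irreducible` of the statement file
`BI17FundamentalInvariantTensors.lean` (cell `val-lit`, row BI2017-B):

* `BI2017_fundInvariantTensor_irreducible_holds : BI2017_fundInvariantTensor_irreducible` —
  `F_n` is irreducible for every `n ≥ 1`.

## Proof (the Lemma 3.19 route, as the print says; the tree's proof of Lemma 3.19 transported)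

The two inputs named by the print are theorems of the tree: `F_n ≠ 0`
(`fundInvariantTensor_ne_zero`, `BI17SL3InvariantDimensionProofs` §10 = Thm. 5.13) and "smallest
degree": `e(n²) = n³` (`BI2017_thm_5_9_part3_minimalDegree`, ibid. §7 = Thm. 5.9 (3)), i.e. there is
no nonzero homogeneous `SL³`-invariant on `⊗³ℂ^{n²}` of degree `0 < i < n³`. The "analog argument"
is the one the tree already formalised for Lemma 3.19 (`BI17CayleyIrreducibleProofs.lean`, t04:
factors of a semi-invariant of `GL_m(ℂ)` are semi-invariants, and their unit characters die on
`SL_m(ℂ)`), here run for the three leg substitutions of the word-model dictionary: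

* §1 makes t04's two steps generic in the action: for any action `φ` of `GL_m(ℂ)` on a polynomial
  ring `ℂ[σ]` by algebra endomorphisms (`φ 1 = id`, `φ (gh) = φ g ∘ φ h`) and any `P ≠ 0` with
  `φ g P ~ P` for all `g`, every divisor `a` of `P` satisfies `φ g a ~ a` (`GL_m(ℂ)` permutes the
  finitely many divisor classes of `P`; a homomorphism `GL_m(ℂ) →` finite group is trivial,
  `GL_monoidHom_eq_one_of_finite`) and then `φ s a = a` for `s ∈ SL_m(ℂ)` (the units form a
  character `GL_m(ℂ) → ℂ^×`, trivial on `SL_m`, `GL_monoidHom_comm_apply_toGL_eq_one`).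
* §2: the leg substitutions `legSubstᵢ` (`KroneckerTriplePoly`) are such actions
  (`legSubstᵢ_one`, `legSubstᵢ_mul`), they are graded (`isHomogeneous_legSubstᵢ`, so they commute
  with `homogeneousComponent`), and a form fixed by the three unimodular leg substitutions is, read
  in BI's variables along `Equiv.prodAssoc`, `IsSL3Invariant` (`isSL3Invariant_rename_of_legSubst_eq`,
  by the evaluation ↔ substitution identities `aeval_tensorPt_actTensor_fst/snd/thd` of
  `BI17SL3InvariantDimensionProofs` §1).
* §3: `F_n = P_{t₀}` reindexed (`fundInvariantTensor_eq_rename_triplePoly`), and `P_{t₀} =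
  triplePoly (ζ_x ⊗ ζ_y ⊗ ζ_z)` is a semi-invariant of each leg, `legSubstᵢ g P_{t₀} = det(g)^n P_{t₀}`
  (`triplePoly_legActᵢ` and `legActᵢ_eq_det_pow_smul_of_mem_tripleHw_rectangle`: `GL_{n²}` acts on
  `HW_□` by `det^n`). If `P_{t₀} = a b` with non-units `a, b`, then `a ≠ 0` has positive degree
  `< n³`, is fixed by the three unimodular leg substitutions (§1), so are its homogeneous components
  (§2), and a nonzero one of degree `0 < i < n³` is (reindexed) a nonzero homogeneous `SL³`-invariant
  of degree `i`, i.e. `i ∈ E(n²)`, contradicting `e(n²) = n³`. Irreducibility passes along the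
  algebra isomorphism `rename prodAssoc` (`MvPolynomial.renameEquiv`, `MulEquiv.irreducible_iff`).

Honest framing: a classical invariant-theory remark made into a kernel-checked theorem;
typed-literature bookkeeping for the cell `val-lit`; VP ≠ VNP is NOT proved and nothing here is
progress on it.

## References

* [BurgisserIkenmeyer2017] P. Bürgisser, C. Ikenmeyer, J. Algebra 477 (2017) 390–434 =
  arXiv:1511.02927, §5.1 (after Thm. 5.13) and §3.2 Lemma 3.19.
* G. Ottaviani, *An invariant regarding Waring's problem for cubic polynomials*, Nagoya Math. J.
  193 (2009), p. 105 (the "analog argument" cited by BI for Lemma 3.19).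

## Tree / Mathlib

Tree: `BI17SL3InvariantDimensionProofs` (`cubeSignTensor`, `cubeSignTensor_mem_tripleHw`,
`fundInvariantTensor_eq_rename_triplePoly`, `fundInvariantTensor_ne_zero`,
`BI2017_thm_5_9_part3_minimalDegree`, `aeval_tensorPt_actTensor_fst/snd/thd`,
`legActᵢ_eq_det_pow_smul_of_mem_tripleHw_rectangle`), `BI17CayleyIrreducibleProofs`
(`GL_monoidHom_eq_one_of_finite`, `GL_monoidHom_comm_apply_toGL_eq_one`), `KroneckerTriplePoly`
(`legSubstᵢ`, `legSubstᵢ_X`, `triplePoly_legActᵢ`, `triplePoly_smul`, `isHomogeneous_triplePoly`,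
`Alpha`), `BI17FundamentalInvariantTensors` (`BI2017_fundInvariantTensor_irreducible`,
`IsSL3Invariant`, `genericTensorDegreeMonoid`, `genericTensorMinimalDegree`),
`QuantumFunctionalsDegenerationProofs` (`actTensor_actTensor`). Mathlib:
`UniqueFactorizationMonoid.fintypeSubtypeDvd`, `Associates`, `MvPolynomial.isUnit_iff_eq_C_of_isReduced`,
`MvPolynomial.totalDegree_mul_of_isDomain`, `MvPolynomial.IsHomogeneous.aeval`,
`MvPolynomial.homogeneousComponent_of_mem`, `MvPolynomial.renameEquiv`, `MulEquiv.irreducible_iff`.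
-/

noncomputable section

open MvPolynomial

namespace Literature.Computability.AlgebraicComplexity

open _root_.Literature.NumberTheory.DiophantineGeometry

/-! ### §1 Divisors of semi-invariants under an action of `GL_m(ℂ)` by algebra endomorphisms -/

section Divisors

variable {m : ℕ} {σ : Type*}

/-- Algebra endomorphisms preserve associatedness (plumbing). [folklore] -/
private theorem associated_map_algHom (ψ : MvPolynomial σ ℂ →ₐ[ℂ] MvPolynomial σ ℂ)
    {a b : MvPolynomial σ ℂ} (h : Associated a b) : Associated (ψ a) (ψ b) := by
  obtain ⟨u, rfl⟩ := h
  exact ⟨Units.map (ψ : MvPolynomial σ ℂ →* _) u, by rw [map_mul, Units.coe_map]; rfl⟩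

/-- **Divisors of a `GL_m`-semi-invariant are carried to associates by `GL_m`**, for any action
`φ` of `GL_m(ℂ)` on `ℂ[σ]` by algebra endomorphisms: if `P ≠ 0` and `φ g P ~ P` for all `g`, then
`φ g a ~ a` for every divisor `a` of `P` and all `g` — `GL_m(ℂ)` permutes the finitely many classes
of divisors of `P` (`UniqueFactorizationMonoid.fintypeSubtypeDvd` on `Associates`), and a
homomorphism from `GL_m(ℂ)` to a finite group is trivial (`GL_monoidHom_eq_one_of_finite`). The
tree's `associated_coordSubst_of_dvd` (BI 2017 Lemma 3.19, t04) with the action made a parameter;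
this is the "analog argument" the print invokes for `F_n`.
[cite: BurgisserIkenmeyer2017, Lemma 3.19 (proof) and §5.1 (after Thm. 5.13)] -/
theorem associated_of_dvd_of_forall_associated
    (φ : GL (Fin m) ℂ → (MvPolynomial σ ℂ →ₐ[ℂ] MvPolynomial σ ℂ))
    (hφ₁ : φ 1 = AlgHom.id ℂ (MvPolynomial σ ℂ)) (hφ : ∀ g h, φ (g * h) = (φ g).comp (φ h))
    {P : MvPolynomial σ ℂ} (hP : P ≠ 0) (hinv : ∀ g : GL (Fin m) ℂ, Associated (φ g P) P)
    {a : MvPolynomial σ ℂ} (ha : a ∣ P) (g : GL (Fin m) ℂ) : Associated (φ g a) a := by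
  classical
  -- the finite type of classes of divisors of `P`
  let T := {x : Associates (MvPolynomial σ ℂ) // x ∣ Associates.mk P}
  haveI : Fintype T :=
    UniqueFactorizationMonoid.fintypeSubtypeDvd _ (Associates.mk_ne_zero.mpr hP)
  -- the action on `Associates`
  let F : GL (Fin m) ℂ → Associates (MvPolynomial σ ℂ) → Associates (MvPolynomial σ ℂ) := fun g =>
    Quotient.map (φ g) fun a b (h : Associated a b) => associated_map_algHom (φ g) h
  have hFmk : ∀ (g : GL (Fin m) ℂ) (a : MvPolynomial σ ℂ),
      F g (Associates.mk a) = Associates.mk (φ g a) := fun g a => rfl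
  have hF1 : ∀ x, F 1 x = x := by
    intro x
    induction x using Quotient.inductionOn with
    | h a => change F 1 (Associates.mk a) = Associates.mk a; rw [hFmk, hφ₁]; rfl
  have hFmul : ∀ g h x, F (g * h) x = F g (F h x) := by
    intro g h x
    induction x using Quotient.inductionOn with
    | h a =>
      change F (g * h) (Associates.mk a) = F g (F h (Associates.mk a))
      rw [hFmk, hFmk, hFmk, hφ]
      rfl
  -- `F g` maps divisor classes of `P` to divisor classes of `P`
  have hFT : ∀ (g : GL (Fin m) ℂ) (x : T), F g x.1 ∣ Associates.mk P := by
    rintro g ⟨x, hx⟩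
    induction x using Quotient.inductionOn with
    | h b =>
      change F g (Associates.mk b) ∣ Associates.mk P
      rw [hFmk, Associates.mk_dvd_mk]
      have hb : b ∣ P := Associates.mk_dvd_mk.mp hx
      exact (hinv g).dvd_iff_dvd_right.mp (map_dvd (φ g) hb)
  -- the permutation representation
  let π₀ : GL (Fin m) ℂ → Equiv.Perm T := fun g =>
    { toFun := fun x => ⟨F g x.1, hFT g x⟩
      invFun := fun x => ⟨F g⁻¹ x.1, hFT g⁻¹ x⟩
      left_inv := fun x => Subtype.ext (by
        change F g⁻¹ (F g x.1) = x.1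
        rw [← hFmul, inv_mul_cancel, hF1])
      right_inv := fun x => Subtype.ext (by
        change F g (F g⁻¹ x.1) = x.1
        rw [← hFmul, mul_inv_cancel, hF1]) }
  let π : GL (Fin m) ℂ →* Equiv.Perm T :=
    { toFun := π₀
      map_one' := Equiv.ext fun x => Subtype.ext (hF1 x.1)
      map_mul' := fun g h => Equiv.ext fun x => Subtype.ext (hFmul g h x.1) }
  have hπ : π g = 1 := GL_monoidHom_eq_one_of_finite π g
  have hx : π₀ g ⟨Associates.mk a, Associates.mk_dvd_mk.mpr ha⟩ =
      ⟨Associates.mk a, Associates.mk_dvd_mk.mpr ha⟩ := by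
    change π g _ = _
    rw [hπ]
    rfl
  have hx' := congrArg Subtype.val hx
  change F g (Associates.mk a) = Associates.mk a at hx'
  rw [hFmk, Associates.mk_eq_mk_iff_associated] at hx'
  exact hx'

/-- Cancelling a nonzero polynomial: `C r * a = C r' * a ⇒ r = r'` (plumbing). [folklore] -/
private theorem C_mul_cancel' {a : MvPolynomial σ ℂ} (ha : a ≠ 0) {r r' : ℂ}
    (h : C r * a = C r' * a) : r = r' :=
  C_injective _ _ (mul_right_cancel₀ ha h)

/-- **A polynomial carried to associates by all of `GL_m(ℂ)` is fixed by `SL_m(ℂ)`**, for any action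
`φ` of `GL_m(ℂ)` on `ℂ[σ]` by algebra endomorphisms: the units `c_g ∈ ℂ^×` with `φ g a = c_g a` form
a homomorphism `GL_m(ℂ) → ℂ^×`, which is trivial on `SL_m(ℂ)`
(`GL_monoidHom_comm_apply_toGL_eq_one`). The tree's
`isSLInvariantCoord_of_forall_associated_coordSubst` (BI 2017 Lemma 3.19, t04) with the action made
a parameter. [cite: BurgisserIkenmeyer2017, Lemma 3.19 (proof) and §5.1 (after Thm. 5.13)] -/
theorem eq_of_forall_associated
    (φ : GL (Fin m) ℂ → (MvPolynomial σ ℂ →ₐ[ℂ] MvPolynomial σ ℂ))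
    (hφ₁ : φ 1 = AlgHom.id ℂ (MvPolynomial σ ℂ)) (hφ : ∀ g h, φ (g * h) = (φ g).comp (φ h))
    {a : MvPolynomial σ ℂ} (ha : a ≠ 0) (hass : ∀ g : GL (Fin m) ℂ, Associated (φ g a) a)
    (s : Matrix.SpecialLinearGroup (Fin m) ℂ) : φ (Matrix.SpecialLinearGroup.toGL s) a = a := by
  classical
  -- the unit scalars
  have hex : ∀ g : GL (Fin m) ℂ, ∃ r : ℂ, r ≠ 0 ∧ φ g a = C r * a := by
    intro g
    obtain ⟨u, hu⟩ := hass g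
    obtain ⟨r, hr, hur⟩ := (MvPolynomial.isUnit_iff_eq_C_of_isReduced (P := ((u⁻¹ : _ˣ) :
      MvPolynomial σ ℂ))).mp (u⁻¹).isUnit
    refine ⟨r, hr.ne_zero, ?_⟩
    calc φ g a = φ g a * ↑u * ↑u⁻¹ := by rw [mul_assoc, Units.mul_inv, mul_one]
      _ = a * ↑u⁻¹ := by rw [hu]
      _ = C r * a := by rw [hur, mul_comm]
  choose r hr0 hr using hex
  -- they form a homomorphism `GL → ℂˣ`
  have hmul : ∀ g h, r (g * h) = r g * r h := by
    intro g h
    apply C_mul_cancel' ha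
    rw [← hr, hφ, AlgHom.comp_apply, hr h, map_mul, MvPolynomial.algHom_C,
      MvPolynomial.algebraMap_eq, hr g, ← mul_assoc, ← map_mul, mul_comm (r h)]
  have hone : r 1 = 1 := by
    apply C_mul_cancel' ha
    rw [← hr, hφ₁, AlgHom.id_apply, map_one, one_mul]
  let c : GL (Fin m) ℂ →* ℂˣ :=
    { toFun := fun g => Units.mk0 (r g) (hr0 g)
      map_one' := Units.ext hone
      map_mul' := fun g h => Units.ext (hmul g h) }
  have hc : c (Matrix.SpecialLinearGroup.toGL s) = 1 := GL_monoidHom_comm_apply_toGL_eq_one c s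
  have hr1 : r (Matrix.SpecialLinearGroup.toGL s) = 1 := by
    have := congrArg Units.val hc
    exact this
  rw [hr, hr1, map_one, one_mul]

/-- **Divisors of a nonzero semi-invariant are fixed by `SL_m(ℂ)`** (the two previous steps
combined): if `φ g P ~ P` for all `g ∈ GL_m(ℂ)` and `a ∣ P ≠ 0`, then `φ s a = a` for `s ∈ SL_m(ℂ)`
("factors of a semi-invariant of a connected group are semi-invariants", the argument of BI 2017
Lemma 3.19 invoked for `F_n`). [cite: BurgisserIkenmeyer2017, Lemma 3.19 (proof) and §5.1 (after Thm. 5.13)] -/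
theorem eq_of_dvd_of_forall_associated
    (φ : GL (Fin m) ℂ → (MvPolynomial σ ℂ →ₐ[ℂ] MvPolynomial σ ℂ))
    (hφ₁ : φ 1 = AlgHom.id ℂ (MvPolynomial σ ℂ)) (hφ : ∀ g h, φ (g * h) = (φ g).comp (φ h))
    {P : MvPolynomial σ ℂ} (hP : P ≠ 0) (hinv : ∀ g : GL (Fin m) ℂ, Associated (φ g P) P)
    {a : MvPolynomial σ ℂ} (ha : a ∣ P) (s : Matrix.SpecialLinearGroup (Fin m) ℂ) :
    φ (Matrix.SpecialLinearGroup.toGL s) a = a := by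
  have ha0 : a ≠ 0 := by
    rintro rfl
    exact hP (zero_dvd_iff.mp ha)
  exact eq_of_forall_associated φ hφ₁ hφ ha0
    (associated_of_dvd_of_forall_associated φ hφ₁ hφ hP hinv ha) s

end Divisors

/-! ### §2 The leg substitutions as graded `GL`-actions; leg-fixed forms are `SL³`-invariant -/

section Legs

variable {k : Type*} [Field k] {N : ℕ}

/-- `legSubst₁ 1 = id`. [folklore] -/
private theorem legSubst₁_one : legSubst₁ N (1 : Matrix (Fin N) (Fin N) k) = AlgHom.id k _ := by
  refine MvPolynomial.algHom_ext fun x => ?_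
  rw [legSubst₁_X, AlgHom.id_apply]
  simp only [Matrix.one_apply, ite_smul, one_smul, zero_smul, Finset.sum_ite_eq',
    Finset.mem_univ, if_true, Prod.mk.eta]

/-- `legSubst₂ 1 = id`. [folklore] -/
private theorem legSubst₂_one : legSubst₂ N (1 : Matrix (Fin N) (Fin N) k) = AlgHom.id k _ := by
  refine MvPolynomial.algHom_ext fun x => ?_
  rw [legSubst₂_X, AlgHom.id_apply]
  simp only [Matrix.one_apply, ite_smul, one_smul, zero_smul, Finset.sum_ite_eq',
    Finset.mem_univ, if_true, Prod.mk.eta]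

/-- `legSubst₃ 1 = id`. [folklore] -/
private theorem legSubst₃_one : legSubst₃ N (1 : Matrix (Fin N) (Fin N) k) = AlgHom.id k _ := by
  refine MvPolynomial.algHom_ext fun x => ?_
  rw [legSubst₃_X, AlgHom.id_apply]
  simp only [Matrix.one_apply, ite_smul, one_smul, zero_smul, Finset.sum_ite_eq',
    Finset.mem_univ, if_true, Prod.mk.eta]

/-- `legSubst₁ (A B) = legSubst₁ A ∘ legSubst₁ B` (the column convention makes it a left action).
[folklore] -/
private theorem legSubst₁_mul (A B : Matrix (Fin N) (Fin N) k) :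
    legSubst₁ N (A * B) = (legSubst₁ N A).comp (legSubst₁ N B) := by
  refine MvPolynomial.algHom_ext fun x => ?_
  simp only [AlgHom.comp_apply, legSubst₁_X, map_sum, map_smul, Finset.smul_sum, smul_smul,
    Matrix.mul_apply, Finset.sum_smul]
  rw [Finset.sum_comm]
  exact Finset.sum_congr rfl fun j _ => Finset.sum_congr rfl fun l _ => by rw [mul_comm]

/-- `legSubst₂ (A B) = legSubst₂ A ∘ legSubst₂ B`. [folklore] -/
private theorem legSubst₂_mul (A B : Matrix (Fin N) (Fin N) k) :
    legSubst₂ N (A * B) = (legSubst₂ N A).comp (legSubst₂ N B) := by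
  refine MvPolynomial.algHom_ext fun x => ?_
  simp only [AlgHom.comp_apply, legSubst₂_X, map_sum, map_smul, Finset.smul_sum, smul_smul,
    Matrix.mul_apply, Finset.sum_smul]
  rw [Finset.sum_comm]
  exact Finset.sum_congr rfl fun j _ => Finset.sum_congr rfl fun l _ => by rw [mul_comm]

/-- `legSubst₃ (A B) = legSubst₃ A ∘ legSubst₃ B`. [folklore] -/
private theorem legSubst₃_mul (A B : Matrix (Fin N) (Fin N) k) :
    legSubst₃ N (A * B) = (legSubst₃ N A).comp (legSubst₃ N B) := by
  refine MvPolynomial.algHom_ext fun x => ?_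
  simp only [AlgHom.comp_apply, legSubst₃_X, map_sum, map_smul, Finset.smul_sum, smul_smul,
    Matrix.mul_apply, Finset.sum_smul]
  rw [Finset.sum_comm]
  exact Finset.sum_congr rfl fun j _ => Finset.sum_congr rfl fun l _ => by rw [mul_comm]

/-- The leg substitutions are graded: they map forms of degree `d` to forms of degree `d` (they
substitute linear forms for the variables). [folklore] -/
private theorem isHomogeneous_legSubst₁ (A : Matrix (Fin N) (Fin N) k) {P : MvPolynomial (Alpha N) k}
    {d : ℕ} (hP : P.IsHomogeneous d) : (legSubst₁ N A P).IsHomogeneous d := by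
  have h := hP.aeval (fun x : Alpha N => ∑ l : Fin N, A l x.1.1 • (X ((l, x.1.2), x.2) :
      MvPolynomial (Alpha N) k)) (n := 1) fun x =>
    IsHomogeneous.sum _ _ _ fun l _ => by
      rw [smul_eq_C_mul]; exact isHomogeneous_C_mul_X _ _
  rw [one_mul] at h
  exact h

/-- Second leg: graded. [folklore] -/
private theorem isHomogeneous_legSubst₂ (A : Matrix (Fin N) (Fin N) k) {P : MvPolynomial (Alpha N) k}
    {d : ℕ} (hP : P.IsHomogeneous d) : (legSubst₂ N A P).IsHomogeneous d := by
  have h := hP.aeval (fun x : Alpha N => ∑ i : Fin N, A i x.1.2 • (X ((x.1.1, i), x.2) :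
      MvPolynomial (Alpha N) k)) (n := 1) fun x =>
    IsHomogeneous.sum _ _ _ fun l _ => by
      rw [smul_eq_C_mul]; exact isHomogeneous_C_mul_X _ _
  rw [one_mul] at h
  exact h

/-- Third leg: graded. [folklore] -/
private theorem isHomogeneous_legSubst₃ (A : Matrix (Fin N) (Fin N) k) {P : MvPolynomial (Alpha N) k}
    {d : ℕ} (hP : P.IsHomogeneous d) : (legSubst₃ N A P).IsHomogeneous d := by
  have h := hP.aeval (fun x : Alpha N => ∑ j : Fin N, A j x.2 • (X (x.1, j) :
      MvPolynomial (Alpha N) k)) (n := 1) fun x =>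
    IsHomogeneous.sum _ _ _ fun l _ => by
      rw [smul_eq_C_mul]; exact isHomogeneous_C_mul_X _ _
  rw [one_mul] at h
  exact h

/-- A graded algebra endomorphism commutes with taking homogeneous components (plumbing; the
tree's `homogeneousComponent_coordSubst` with the endomorphism made a parameter). [folklore] -/
private theorem homogeneousComponent_map_of_graded {τ : Type*}
    (ψ : MvPolynomial τ k →ₐ[k] MvPolynomial τ k)
    (hψ : ∀ (d : ℕ) (P : MvPolynomial τ k), P.IsHomogeneous d → (ψ P).IsHomogeneous d)
    (F : MvPolynomial τ k) (i : ℕ) :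
    homogeneousComponent i (ψ F) = ψ (homogeneousComponent i F) := by
  conv_lhs => rw [← sum_homogeneousComponent (φ := F)]
  rw [map_sum, map_sum, Finset.sum_eq_single i]
  · rw [homogeneousComponent_of_mem ((mem_homogeneousSubmodule _ _).mpr
      (hψ _ _ (homogeneousComponent_isHomogeneous i F))), if_pos rfl]
  · intro j _ hji
    rw [homogeneousComponent_of_mem ((mem_homogeneousSubmodule _ _).mpr
      (hψ _ _ (homogeneousComponent_isHomogeneous j F))), if_neg (Ne.symm hji)]
  · intro hi
    have hlt : F.totalDegree < i := by
      rw [Finset.mem_range, not_lt] at hi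
      omega
    rw [MvPolynomial.homogeneousComponent_eq_zero _ _ hlt, map_zero, map_zero]

/-- **Leg-fixed forms are `SL³`-invariant**: a form in the dictionary's variables fixed by the three
unimodular leg substitutions is, read on tensors along `Equiv.prodAssoc`, `SL³`-invariant in BI's
sense (`F((g₁ ⊗ g₂ ⊗ g₃)w) = F(w)`), by `(g₁ ⊗ g₂ ⊗ g₃) = (g₁ ⊗ 1 ⊗ 1)(1 ⊗ g₂ ⊗ 1)(1 ⊗ 1 ⊗ g₃)` and
the evaluation ↔ substitution identities (BI 2017 §5, `O(⊗³ℂ^m)^{SL³_m}`).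
[cite: BurgisserIkenmeyer2017, §5 eq. (5.1)] -/
theorem isSL3Invariant_rename_of_legSubst_eq {P : MvPolynomial (Alpha N) k}
    (h₁ : ∀ A : Matrix (Fin N) (Fin N) k, A.det = 1 → legSubst₁ N A P = P)
    (h₂ : ∀ A : Matrix (Fin N) (Fin N) k, A.det = 1 → legSubst₂ N A P = P)
    (h₃ : ∀ A : Matrix (Fin N) (Fin N) k, A.det = 1 → legSubst₃ N A P = P) :
    IsSL3Invariant (rename (Equiv.prodAssoc (Fin N) (Fin N) (Fin N)) P) := by
  intro g₁ g₂ g₃ w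
  set G₁ : Matrix (Fin N) (Fin N) k := (g₁ : Matrix (Fin N) (Fin N) k) with hG₁
  set G₂ : Matrix (Fin N) (Fin N) k := (g₂ : Matrix (Fin N) (Fin N) k) with hG₂
  set G₃ : Matrix (Fin N) (Fin N) k := (g₃ : Matrix (Fin N) (Fin N) k) with hG₃
  have h : actTensor G₁ G₂ G₃ w =
      actTensor G₁.transpose.transpose (1 : Matrix (Fin N) (Fin N) k) (1 : Matrix (Fin N) (Fin N) k)
        (actTensor (1 : Matrix (Fin N) (Fin N) k) G₂.transpose.transpose (1 : Matrix (Fin N) (Fin N) k)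
          (actTensor (1 : Matrix (Fin N) (Fin N) k) (1 : Matrix (Fin N) (Fin N) k)
            G₃.transpose.transpose w)) := by
    rw [actTensor_actTensor, actTensor_actTensor]
    simp only [Matrix.mul_one, Matrix.one_mul, Matrix.transpose_transpose]
  have hd₁ : G₁.transpose.det = 1 := by rw [Matrix.det_transpose]; exact g₁.2
  have hd₂ : G₂.transpose.det = 1 := by rw [Matrix.det_transpose]; exact g₂.2
  have hd₃ : G₃.transpose.det = 1 := by rw [Matrix.det_transpose]; exact g₃.2
  rw [h, aeval_tensorPt_actTensor_fst, h₁ _ hd₁, aeval_tensorPt_actTensor_snd, h₂ _ hd₂,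
    aeval_tensorPt_actTensor_thd, h₃ _ hd₃]

end Legs

/-! ### §3 `F_n` is irreducible -/

section Irreducible

/-- **`P_{t₀} = triplePoly (ζ_x ⊗ ζ_y ⊗ ζ_z)` is a semi-invariant of the first leg**: `legSubst₁ g
P_{t₀} = det(g)^n · P_{t₀}` for all `g ∈ GL_{n²}` (`GL_{n²}` acts on `HW_□` by `det^n`; Thm. 5.13,
first sentence, in substitution form). [cite: BurgisserIkenmeyer2017, Thm. 5.13] -/
theorem legSubst₁_triplePoly_cubeSignTensor (n : ℕ) (g : GL (Fin (n * n)) ℂ) :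
    legSubst₁ (n * n) (g : Matrix (Fin (n * n)) (Fin (n * n)) ℂ) (triplePoly (cubeSignTensor ℂ n)) =
      C ((g : Matrix (Fin (n * n)) (Fin (n * n)) ℂ).det ^ n) * triplePoly (cubeSignTensor ℂ n) := by
  rw [← triplePoly_legAct₁, legAct₁_eq_det_pow_smul_of_mem_tripleHw_rectangle ℂ
    (cubeSignTensor_mem_tripleHw ℂ n) g, triplePoly_smul, smul_eq_C_mul]

/-- Second leg: `legSubst₂ g P_{t₀} = det(g)^n · P_{t₀}`. [cite: BurgisserIkenmeyer2017, Thm. 5.13] -/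
theorem legSubst₂_triplePoly_cubeSignTensor (n : ℕ) (g : GL (Fin (n * n)) ℂ) :
    legSubst₂ (n * n) (g : Matrix (Fin (n * n)) (Fin (n * n)) ℂ) (triplePoly (cubeSignTensor ℂ n)) =
      C ((g : Matrix (Fin (n * n)) (Fin (n * n)) ℂ).det ^ n) * triplePoly (cubeSignTensor ℂ n) := by
  rw [← triplePoly_legAct₂, legAct₂_eq_det_pow_smul_of_mem_tripleHw_rectangle ℂ
    (cubeSignTensor_mem_tripleHw ℂ n) g, triplePoly_smul, smul_eq_C_mul]

/-- Third leg: `legSubst₃ g P_{t₀} = det(g)^n · P_{t₀}`. [cite: BurgisserIkenmeyer2017, Thm. 5.13] -/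
theorem legSubst₃_triplePoly_cubeSignTensor (n : ℕ) (g : GL (Fin (n * n)) ℂ) :
    legSubst₃ (n * n) (g : Matrix (Fin (n * n)) (Fin (n * n)) ℂ) (triplePoly (cubeSignTensor ℂ n)) =
      C ((g : Matrix (Fin (n * n)) (Fin (n * n)) ℂ).det ^ n) * triplePoly (cubeSignTensor ℂ n) := by
  rw [← triplePoly_legAct₃, legAct₃_eq_det_pow_smul_of_mem_tripleHw_rectangle ℂ
    (cubeSignTensor_mem_tripleHw ℂ n) g, triplePoly_smul, smul_eq_C_mul]

/-- `P_{t₀} ≠ 0` (it is `F_n ≠ 0` reindexed). [cite: BurgisserIkenmeyer2017, Thm. 5.13] -/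
theorem triplePoly_cubeSignTensor_ne_zero (n : ℕ) : triplePoly (cubeSignTensor ℂ n) ≠ 0 := by
  intro h
  apply fundInvariantTensor_ne_zero n
  rw [fundInvariantTensor_eq_rename_triplePoly ℂ n, h, map_zero]

/-- **Divisors of `P_{t₀}` are fixed by the three unimodular leg substitutions** (§1 applied to the
three leg actions, `P_{t₀}` being a semi-invariant of each).
[cite: BurgisserIkenmeyer2017, §5.1 (after Thm. 5.13)] -/
theorem legSubst_eq_of_dvd_triplePoly_cubeSignTensor (n : ℕ) {a : MvPolynomial (Alpha (n * n)) ℂ}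
    (ha : a ∣ triplePoly (cubeSignTensor ℂ n)) (A : Matrix (Fin (n * n)) (Fin (n * n)) ℂ)
    (hA : A.det = 1) :
    legSubst₁ (n * n) A a = a ∧ legSubst₂ (n * n) A a = a ∧ legSubst₃ (n * n) A a = a := by
  have hP := triplePoly_cubeSignTensor_ne_zero n
  set s : Matrix.SpecialLinearGroup (Fin (n * n)) ℂ := ⟨A, hA⟩ with hs
  have hsA : ((Matrix.SpecialLinearGroup.toGL s : GL (Fin (n * n)) ℂ) :
      Matrix (Fin (n * n)) (Fin (n * n)) ℂ) = A := by
    rw [Matrix.SpecialLinearGroup.coe_GL_coe_matrix, hs]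
  have hunit : ∀ g : GL (Fin (n * n)) ℂ,
      IsUnit (C ((g : Matrix (Fin (n * n)) (Fin (n * n)) ℂ).det ^ n) : MvPolynomial (Alpha (n * n)) ℂ) :=
    fun g => (IsUnit.pow n (isUnit_iff_ne_zero.mpr g.det_ne_zero)).map C
  refine ⟨?_, ?_, ?_⟩
  · have h := eq_of_dvd_of_forall_associated
      (fun g : GL (Fin (n * n)) ℂ => legSubst₁ (n * n) (g : Matrix (Fin (n * n)) (Fin (n * n)) ℂ))
      (by rw [Units.val_one, legSubst₁_one]) (fun g h => by rw [Units.val_mul, legSubst₁_mul]) hP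
      (fun g => by
        rw [legSubst₁_triplePoly_cubeSignTensor]
        exact associated_unit_mul_left _ _ (hunit g)) ha s
    rwa [hsA] at h
  · have h := eq_of_dvd_of_forall_associated
      (fun g : GL (Fin (n * n)) ℂ => legSubst₂ (n * n) (g : Matrix (Fin (n * n)) (Fin (n * n)) ℂ))
      (by rw [Units.val_one, legSubst₂_one]) (fun g h => by rw [Units.val_mul, legSubst₂_mul]) hP
      (fun g => by
        rw [legSubst₂_triplePoly_cubeSignTensor]
        exact associated_unit_mul_left _ _ (hunit g)) ha s
    rwa [hsA] at h
  · have h := eq_of_dvd_of_forall_associated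
      (fun g : GL (Fin (n * n)) ℂ => legSubst₃ (n * n) (g : Matrix (Fin (n * n)) (Fin (n * n)) ℂ))
      (by rw [Units.val_one, legSubst₃_one]) (fun g h => by rw [Units.val_mul, legSubst₃_mul]) hP
      (fun g => by
        rw [legSubst₃_triplePoly_cubeSignTensor]
        exact associated_unit_mul_left _ _ (hunit g)) ha s
    rwa [hsA] at h

/-- **`P_{t₀}` is irreducible** (`n ≥ 1`): a proper factor `a` (nonzero, of positive degree `< n³`)
is fixed by the unimodular leg substitutions, hence so are its homogeneous components (the legs are
graded); a nonzero one of degree `0 < i < n³` is, reindexed, a nonzero homogeneous `SL³`-invariant of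
degree `i` on `⊗³ℂ^{n²}`, contradicting the minimality `e(n²) = n³` of Thm. 5.9 (3).
[cite: BurgisserIkenmeyer2017, §5.1 (after Thm. 5.13)] -/
theorem irreducible_triplePoly_cubeSignTensor (n : ℕ) (hn : 1 ≤ n) :
    Irreducible (triplePoly (cubeSignTensor ℂ n)) := by
  set P := triplePoly (cubeSignTensor ℂ n) with hPdef
  have hPhom : P.IsHomogeneous (n * n * n) := isHomogeneous_triplePoly _
  have hP0 : P ≠ 0 := triplePoly_cubeSignTensor_ne_zero n
  have hPdeg : P.totalDegree = n * n * n := hPhom.totalDegree hP0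
  have hn3 : 0 < n * n * n := Nat.mul_pos (Nat.mul_pos hn hn) hn
  -- non-units have positive total degree
  have hdeg_pos : ∀ a : MvPolynomial (Alpha (n * n)) ℂ, a ≠ 0 → ¬ IsUnit a →
      0 < a.totalDegree := by
    intro a ha hu
    by_contra h0
    have h0' : a.totalDegree = 0 := by omega
    rw [totalDegree_eq_zero_iff_eq_C] at h0'
    apply hu
    rw [h0']
    refine (isUnit_iff_ne_zero.mpr ?_).map C
    intro hc
    apply ha
    rw [h0', hc, map_zero]
  refine ⟨fun hu => ?_, fun a b hab => ?_⟩
  · -- `P` is not a unit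
    obtain ⟨r, -, hr⟩ := MvPolynomial.isUnit_iff_eq_C_of_isReduced.mp hu
    have h0 : P.IsHomogeneous 0 := by
      rw [hr]
      exact isHomogeneous_C _ _
    have := hPhom.inj_right h0 hP0
    omega
  · -- a factorisation `P = a * b`
    by_contra hcon
    push Not at hcon
    obtain ⟨hua, hub⟩ := hcon
    have ha0 : a ≠ 0 := by
      rintro rfl
      exact hP0 (by rw [hab, zero_mul])
    have hb0 : b ≠ 0 := by
      rintro rfl
      exact hP0 (by rw [hab, mul_zero])
    have hda := hdeg_pos a ha0 hua
    have hdb := hdeg_pos b hb0 hub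
    have hsum : a.totalDegree + b.totalDegree = n * n * n := by
      rw [← totalDegree_mul_of_isDomain ha0 hb0, ← hab, hPdeg]
    -- `a` is fixed by the unimodular leg substitutions
    have hfix := fun A (hA : Matrix.det A = 1) =>
      legSubst_eq_of_dvd_triplePoly_cubeSignTensor n (a := a) ⟨b, hab⟩ A hA
    -- a nonzero homogeneous component of `a` of positive degree
    obtain ⟨i, hi0, hile, hci⟩ :
        ∃ i, 0 < i ∧ i ≤ a.totalDegree ∧ homogeneousComponent i a ≠ 0 := by
      by_contra hnone
      push Not at hnone
      have ha_eq : a = homogeneousComponent 0 a := by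
        conv_lhs => rw [← sum_homogeneousComponent (φ := a)]
        rw [Finset.sum_eq_single 0]
        · intro j hj hj0
          exact hnone j (Nat.pos_of_ne_zero hj0)
            (Nat.lt_succ_iff.mp (Finset.mem_range.mp hj))
        · intro h
          exact absurd (Finset.mem_range.mpr (Nat.succ_pos _)) h
      rw [homogeneousComponent_zero] at ha_eq
      have : a.totalDegree = 0 := by
        rw [ha_eq]
        exact totalDegree_C _
      omega
    -- it is fixed by the unimodular leg substitutions, hence `SL³`-invariant after reindexing
    set c := homogeneousComponent i a with hc
    have hc₁ : ∀ A : Matrix (Fin (n * n)) (Fin (n * n)) ℂ, A.det = 1 → legSubst₁ (n * n) A c = c :=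
      fun A hA => by
        rw [hc, ← homogeneousComponent_map_of_graded _ (fun d P hP => isHomogeneous_legSubst₁ A hP),
          (hfix A hA).1]
    have hc₂ : ∀ A : Matrix (Fin (n * n)) (Fin (n * n)) ℂ, A.det = 1 → legSubst₂ (n * n) A c = c :=
      fun A hA => by
        rw [hc, ← homogeneousComponent_map_of_graded _ (fun d P hP => isHomogeneous_legSubst₂ A hP),
          (hfix A hA).2.1]
    have hc₃ : ∀ A : Matrix (Fin (n * n)) (Fin (n * n)) ℂ, A.det = 1 → legSubst₃ (n * n) A c = c :=
      fun A hA => by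
        rw [hc, ← homogeneousComponent_map_of_graded _ (fun d P hP => isHomogeneous_legSubst₃ A hP),
          (hfix A hA).2.2]
    have hinv := isSL3Invariant_rename_of_legSubst_eq hc₁ hc₂ hc₃
    -- so `i ∈ E(n²)` with `0 < i < n³ = e(n²)`: contradiction
    have hmem : i ∈ genericTensorDegreeMonoid (Fin (n * n)) ℂ :=
      ⟨rename (Equiv.prodAssoc (Fin (n * n)) (Fin (n * n)) (Fin (n * n))) c,
        (homogeneousComponent_isHomogeneous i a).rename_isHomogeneous, hinv,
        fun h => hci (rename_injective _ (Equiv.injective _) (by rw [h, map_zero]))⟩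
    have hle : genericTensorMinimalDegree (Fin (n * n)) ℂ ≤ i := Nat.sInf_le ⟨hmem, hi0⟩
    rw [BI2017_thm_5_9_part3_minimalDegree n hn] at hle
    omega

/-- **BI 2017, §5.1 (after Thm. 5.13) — DISCHARGED: "the generic fundamental invariant `F_n` is an
irreducible polynomial"** (`n ≥ 1`), by the route the print names ("As for Lemma 3.19"): `F_n ≠ 0`
is a nonzero `SL³`-invariant of smallest degree `e(n²) = n³`, and divisors of semi-invariants are
invariant. `F_n = P_{t₀}` along the algebra isomorphism `rename prodAssoc`.
[cite: BurgisserIkenmeyer2017, §5.1 (after Thm. 5.13)] -/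
theorem BI2017_fundInvariantTensor_irreducible_holds : BI2017_fundInvariantTensor_irreducible := by
  intro n hn
  rw [fundInvariantTensor_eq_rename_triplePoly ℂ n,
    ← MvPolynomial.renameEquiv_apply ℂ (Equiv.prodAssoc (Fin (n * n)) (Fin (n * n)) (Fin (n * n)))]
  exact (MulEquiv.irreducible_iff _).mpr (irreducible_triplePoly_cubeSignTensor n hn)

end Irreducible

end Literature.Computability.AlgebraicComplexity
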